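import Mathlib

/-!
# SoloBlind kernel #216 — coercivity of "absorption + skew hopping + small feedback" (the certified tail start)

For the A8-CAP engine the block continued fraction must start from a certified enclosure of the true tail value
`R_{M₀+1}`.  The tail operator of the frozen column generator has the form `T = D + S + E` with `D` the diagonal
absorption (`Re ⟪x, D x⟫ ≥ d ‖x‖²`, `d = ε K₀ (M₀+1)² + Re z`), `S` the skew-Hermitian hopping (`Re ⟪x, S x⟫ = 0`) and
`E` the small non-skew feedback part (`‖E x‖ ≤ e ‖x‖`).  Then `T` is `(d - e)`-coercive in real part, which is the
hypothesis of kernel #214 (`coercive_solve`): the tail solve exists with `‖x‖ ≤ ‖y‖ / (d - e)`.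
-/

namespace Summit.AnomalousDissipation.AnomalousDissipation.Theorems

open scoped InnerProductSpace

variable {E : Type*} [NormedAddCommGroup E] [InnerProductSpace ℂ E]

/-- A skew-Hermitian operator has purely imaginary quadratic form. -/
theorem re_inner_skew_eq_zero (S : E →ₗ[ℂ] E) (hS : ∀ x y : E, ⟪S x, y⟫_ℂ = -⟪x, S y⟫_ℂ) (x : E) :
    (⟪x, S x⟫_ℂ).re = 0 := by
  have h1 : ⟪x, S x⟫_ℂ = -(starRingEnd ℂ) ⟪x, S x⟫_ℂ := by
    rw [inner_conj_symm, hS, neg_neg]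
  have h2 := congrArg Complex.re h1
  rw [Complex.neg_re, Complex.conj_re] at h2
  linarith

/-- Coercivity of `D + S + E`: absorption minus the size of the non-skew part. -/
theorem coercive_tail (D S E' : E →ₗ[ℂ] E) (d e : ℝ)
    (hD : ∀ x : E, d * ‖x‖ ^ 2 ≤ (⟪x, D x⟫_ℂ).re)
    (hS : ∀ x y : E, ⟪S x, y⟫_ℂ = -⟪x, S y⟫_ℂ)
    (hE : ∀ x : E, ‖E' x‖ ≤ e * ‖x‖) (x : E) :
    (d - e) * ‖x‖ ^ 2 ≤ (⟪x, (D + S + E') x⟫_ℂ).re := by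
  have hsplit : ⟪x, (D + S + E') x⟫_ℂ = ⟪x, D x⟫_ℂ + ⟪x, S x⟫_ℂ + ⟪x, E' x⟫_ℂ := by
    simp only [LinearMap.add_apply, inner_add_right]
  rw [hsplit, Complex.add_re, Complex.add_re, re_inner_skew_eq_zero S hS x, add_zero]
  have hEx : -(e * ‖x‖ ^ 2) ≤ (⟪x, E' x⟫_ℂ).re := by
    have h1 : |(⟪x, E' x⟫_ℂ).re| ≤ ‖⟪x, E' x⟫_ℂ‖ := Complex.abs_re_le_norm _
    have h2 : ‖⟪x, E' x⟫_ℂ‖ ≤ ‖x‖ * ‖E' x‖ := norm_inner_le_norm _ _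
    have h3 : ‖x‖ * ‖E' x‖ ≤ ‖x‖ * (e * ‖x‖) := by gcongr; exact hE x
    have h4 := neg_abs_le (⟪x, E' x⟫_ℂ).re
    nlinarith
  nlinarith [hD x]

/-- The form used by kernel #214: `(d - e) ‖x‖² ≤ ‖⟪x, T x⟫‖`. -/
theorem coercive_tail_norm (D S E' : E →ₗ[ℂ] E) (d e : ℝ)
    (hD : ∀ x : E, d * ‖x‖ ^ 2 ≤ (⟪x, D x⟫_ℂ).re)
    (hS : ∀ x y : E, ⟪S x, y⟫_ℂ = -⟪x, S y⟫_ℂ)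
    (hE : ∀ x : E, ‖E' x‖ ≤ e * ‖x‖) (x : E) :
    (d - e) * ‖x‖ ^ 2 ≤ ‖⟪x, (D + S + E') x⟫_ℂ‖ :=
  le_trans (coercive_tail D S E' d e hD hS hE x) (Complex.re_le_norm _)

/-- A priori bound: if `T x = y` with `T` `(d-e)`-coercive and `d > e`, then `‖x‖ ≤ ‖y‖ / (d - e)`
(the certified radius of the tail value `R_{M₀+1} = T⁻¹ C`). -/
theorem tail_apriori (D S E' : E →ₗ[ℂ] E) (d e : ℝ) (hde : e < d)
    (hD : ∀ x : E, d * ‖x‖ ^ 2 ≤ (⟪x, D x⟫_ℂ).re)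
    (hS : ∀ x y : E, ⟪S x, y⟫_ℂ = -⟪x, S y⟫_ℂ)
    (hE : ∀ x : E, ‖E' x‖ ≤ e * ‖x‖) (x y : E) (hxy : (D + S + E') x = y) :
    ‖x‖ ≤ ‖y‖ / (d - e) := by
  have hc := coercive_tail_norm D S E' d e hD hS hE x
  rw [hxy] at hc
  have hin : ‖⟪x, y⟫_ℂ‖ ≤ ‖x‖ * ‖y‖ := norm_inner_le_norm _ _
  have hpos : 0 < d - e := by linarith
  rw [le_div_iff₀ hpos]
  by_cases hx : ‖x‖ = 0
  · rw [hx]; simp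
  · have hxpos : 0 < ‖x‖ := lt_of_le_of_ne (norm_nonneg _) (Ne.symm hx)
    have : (d - e) * ‖x‖ ^ 2 ≤ ‖x‖ * ‖y‖ := le_trans hc hin
    nlinarith

end Summit.AnomalousDissipation.AnomalousDissipation.Theorems
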